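import Summits.BirchSwinnertonDyer.BirchSwinnertonDyer.Theses.ShaPrimaryTransfer
import Literature.NumberTheory.EllipticCurves.Curve6137TwoIsogenyDescent
import HarnessLib

/-!
# Route ShaPrimaryTransfer — the cross-prime CARRIER: the door at `2` is open on the `ℤ/6ℤ`-curve
# `y² − 21xy + 6137y = x³` (rank `2`), and what `T = FiniteShaComponentTransfer` predicts on it

Helper for item stmt-BirchSwinnertonDyer-22356 (`FiniteShaComponentTransfer`, «T»; conjecture-grade at rank
`≥ 2`) of route `route-BirchSwinnertonDyer-ShaPrimaryTransfer`. BSD is NOT proved by any of this; no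
beyond-print theorem is claimed.

The seven previous generations of this seat certified T's HYPOTHESIS (`t_p(E) = 0` at one prime on a curve
of rank `≥ 2`) on many curves — at `p = 2` (`j = 1728` and Zywina families) and at `p = 3` (`j = 0`, Mordell
curves) — but never its CONCLUSION at a second prime on the same curve: a CROSS-PRIME CELL (`t_2 = t_3 = 0`
on one rank-`2` non-CM curve) needs a curve carrying both a `2`-isogeny and a `3`-isogeny with `ℤ/3ℤ`
kernel, i.e. a rational point of order `6`. This file fixes the carrier and records its prime-`2` side,
proved in `Literature/NumberTheory/EllipticCurves/Curve6137TwoIsogenyDescent.lean`: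

  `E₆₁₃₇ : y² = x³ − 3891x² + 3950784x` (two-torsion normal form of `y² − 21xy + 6137y = x³`, Kubert's
  `ℤ/6ℤ`-family at `c = −19/36`): `rank E(ℚ) = 2`, `Ш(E/ℚ)[2] = 0`, `t_2 = corank_{ℤ₂} Ш(E)[2^∞] = 0`,
  `corank Sel_{2^∞} = 2`.

* the door at `2` is open on the carrier (`Carrier6137.shaCorank_two`, `Carrier6137.mordellWeilRank_eq_two`):
  T's hypothesis at `p₀ = 2`, O's witness `p₀ = 2` (`carrier_oneFiniteShaComponent`).
* `carrier_shaCorank_eq_zero_of_transfer` — **T BY NAME predicts `t_q(E₆₁₃₇) = 0` for EVERY prime `q`**;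
  the first testable instance is `q = 3`, by the `3`-isogeny descent of
  `Literature/…/ThreeTorsionDescentHom.lean` + `…Valuation.lean` (both `3`-Selmer boxes of this curve are
  filled by rational points — seat census, prover-bsd-line-spt-p1 g8) — the successor's target
  `(⟨0, −3891, 0, 3950784, 0⟩ : WeierstrassCurve ℚ).shaCorank 3 = 0`.
* `finiteShaComponentTransfer_carrier_two_iff` — on the carrier, T's instances with `p = 2` are exactly
  the statements `t_q = 0`.
-/

set_option linter.dupNamespace false

namespace Summit.BirchSwinnertonDyer.BirchSwinnertonDyer.Theorems.ShaPrimaryTransferCarrier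

open Summit.BirchSwinnertonDyer.BirchSwinnertonDyer.Theses.ShaPrimaryTransfer
open Literature.NumberTheory.EllipticCurves

/-- The carrier satisfies `O = OneFiniteShaComponent` with the witness `p₀ = 2`. -/
theorem carrier_oneFiniteShaComponent :
    ∃ (p : ℕ) (_ : Fact p.Prime), (⟨0, -3891, 0, 3950784, 0⟩ : WeierstrassCurve ℚ).shaCorank p = 0 :=
  ⟨2, ⟨Nat.prime_two⟩, Carrier6137.shaCorank_two⟩

/-- **`T` BY NAME, applied to the carrier: `FiniteShaComponentTransfer` predicts `t_q(E₆₁₃₇) = 0` for every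
prime `q`** (from the open door at `2`). The instance `q = 3` is the successor's target, to be CERTIFIED
independently by the `3`-isogeny descent — the first cross-prime cell of the route. -/
theorem carrier_shaCorank_eq_zero_of_transfer (hT : FiniteShaComponentTransfer) (q : ℕ) [Fact q.Prime] :
    (⟨0, -3891, 0, 3950784, 0⟩ : WeierstrassCurve ℚ).shaCorank q = 0 := by
  haveI := Carrier6137.isElliptic_E
  haveI : Fact (Nat.Prime 2) := ⟨Nat.prime_two⟩
  exact hT _ 2 q Carrier6137.shaCorank_two

/-- On the carrier the `p = 2` instances of `T` are exactly the statements `t_q = 0`: the hypothesis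
`t_2 = 0` is discharged. -/
theorem finiteShaComponentTransfer_carrier_two_iff (q : ℕ) [Fact q.Prime] :
    ((⟨0, -3891, 0, 3950784, 0⟩ : WeierstrassCurve ℚ).shaCorank 2 = 0 →
        (⟨0, -3891, 0, 3950784, 0⟩ : WeierstrassCurve ℚ).shaCorank q = 0) ↔
      (⟨0, -3891, 0, 3950784, 0⟩ : WeierstrassCurve ℚ).shaCorank q = 0 :=
  ⟨fun h => h Carrier6137.shaCorank_two, fun h _ => h⟩

/-- **Greenberg's identity on the carrier at every prime**: `corank_{ℤ_q} Sel_{q^∞}(E₆₁₃₇) = 2 + t_q(E₆₁₃₇)`,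
so `T` predicts `corank Sel_{q^∞} = 2` for all `q` (certified at `q = 2`:
`Carrier6137.selmerCorank_two`). -/
theorem carrier_selmerCorank_eq (q : ℕ) [Fact q.Prime] :
    (⟨0, -3891, 0, 3950784, 0⟩ : WeierstrassCurve ℚ).selmerCorank q =
      2 + (⟨0, -3891, 0, 3950784, 0⟩ : WeierstrassCurve ℚ).shaCorank q := by
  haveI := Carrier6137.isElliptic_E
  rw [WeierstrassCurve.selmerCorank_eq_mordellWeilRank_add_holds, Carrier6137.mordellWeilRank_eq_two]

end Summit.BirchSwinnertonDyer.BirchSwinnertonDyer.Theorems.ShaPrimaryTransferCarrier
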